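import Literature.MathematicalPhysics.StatisticalMechanics.BarlowCoordination
import HarnessLib

/-!
# The three adjacent-layer offsets, unfolded (helper for the refined word-uniform surface rung
# toward `StackingLiminf`, stmt-Ventures-19145)

Cell `crystal3d-full`.  `threeOffsets τ` of `BarlowCoordination.lean` is `{(0,0), (−τ,0), (0,−τ)}`
for `τ = ±1`; two rewriting lemmas used by `StickyWulffConstantStackingLiminfRefinedProfile.lean`.
WHAT THIS IS NOT: anything new; bookkeeping.
-/

namespace Summit.Ventures.Crystal3D.Theorems

open Finset
open Literature.MathematicalPhysics.StatisticalMechanics (threeOffsets)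

/-- Membership in `threeOffsets τ` (`τ = ±1`): the offsets are `(0,0)`, `(−τ,0)`, `(0,−τ)`. -/
theorem mem_threeOffsets_iff' {τ : ℤ} (hτ : τ = 1 ∨ τ = -1) (u v : ℤ) :
    (u, v) ∈ threeOffsets τ ↔ (u = 0 ∧ v = 0) ∨ (u = -τ ∧ v = 0) ∨ (u = 0 ∧ v = -τ) := by
  rcases hτ with rfl | rfl
  · simp only [threeOffsets, if_true, Finset.mem_insert, Finset.mem_singleton, Prod.mk.injEq]
  · simp only [threeOffsets, show (-1 : ℤ) ≠ 1 by decide, if_false, Finset.mem_insert,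
      Finset.mem_singleton, Prod.mk.injEq]
    omega

/-- `∀ o ∈ threeOffsets τ, P o` unfolded (`τ = ±1`). -/
theorem forall_mem_threeOffsets_iff {τ : ℤ} (hτ : τ = 1 ∨ τ = -1) (P : ℤ × ℤ → Prop) :
    (∀ o ∈ threeOffsets τ, P o) ↔ P (0, 0) ∧ P (-τ, 0) ∧ P (0, -τ) := by
  constructor
  · intro h
    exact ⟨h _ ((mem_threeOffsets_iff' hτ 0 0).2 (by omega)),
      h _ ((mem_threeOffsets_iff' hτ _ _).2 (by omega)),
      h _ ((mem_threeOffsets_iff' hτ _ _).2 (by omega))⟩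
  · rintro ⟨h0, h1, h2⟩ ⟨u, v⟩ ho
    rcases (mem_threeOffsets_iff' hτ u v).1 ho with ⟨rfl, rfl⟩ | ⟨rfl, rfl⟩ | ⟨rfl, rfl⟩
    · exact h0
    · exact h1
    · exact h2

end Summit.Ventures.Crystal3D.Theorems
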